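import Mathlib
import HarnessLib

/-!
# Stub `stub_lapRecursionLipschitz` of the line `Sketch`
# (crux `DyadicWallCascade.ViscousContinuation`, stmt-AnomalousDissipation-17917)

Sorry-free discharge of the registered stub `stub_lapRecursionLipschitz` of the lead's skeleton
(`Cruxes/ViscousContinuation/Lines/Sketch.lean`, line `Sketch`, crux stmt-AnomalousDissipation-17917,
`Summit.AnomalousDissipation.AnomalousDissipation.Theses.DyadicWallCascade.ViscousContinuation`).
It is the card lap-map-koopman-transfer's toy "`C¹` slaving" lemma and is OFF the composition chain:
pure metric-space analysis, Mathlib only.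

**Statement.**  Let `τ : α ≃ α` be a bijection of a pseudo-metric space whose inverse `τ⁻¹` is
non-expanding (`1`-Lipschitz), and let `I : α → ℝ` be bounded (`|I| ≤ C`) and `K`-Lipschitz.  Then the
Neumann-series solution `g q = ∑ₙ (1/2)^(n+1) I (τ⁻¹^[n+1] q)` of the weight-`½` Koopman recursion
`g ∘ τ = (g + I)/2` is `K`-Lipschitz.

**Proof.**  Each iterate `τ⁻¹^[n]` is `1`-Lipschitz, so `I ∘ τ⁻¹^[n+1]` is `K`-Lipschitz and the `n`-th
term satisfies `fₙ x ≤ fₙ y + (1/2)^(n+1) K dist x y`.  The series converges absolutely at every point by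
comparison with the geometric majorant `C (1/2)^(n+1)` (`∑ₙ (1/2)^(n+1) = 1`), so summing the termwise
inequality gives `g x ≤ g y + K dist x y`, which is the one-sided Lipschitz criterion for real-valued maps
(`LipschitzWith.of_le_add_mul`).
-/

set_option linter.dupNamespace false

namespace Summit.AnomalousDissipation.AnomalousDissipation.Theorems

/-- The shifted dyadic geometric series: `∑ₙ (1/2)^(n+1) = 1`. [folklore] -/
theorem lapLipschitz_hasSum_geometric_half_succ :
    HasSum (fun n : ℕ => (1 / 2 : ℝ) ^ (n + 1)) 1 := by
  have h := hasSum_geometric_two.mul_right (1 / 2 : ℝ)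
  simp only [← pow_succ] at h
  rwa [show (2 : ℝ) * (1 / 2) = 1 by norm_num] at h

/-- The shifted dyadic geometric series with a constant factor: `∑ₙ (1/2)^(n+1) c = c`. [folklore] -/
theorem lapLipschitz_hasSum_geometric_half_succ_mul (c : ℝ) :
    HasSum (fun n : ℕ => (1 / 2 : ℝ) ^ (n + 1) * c) c := by
  have h := lapLipschitz_hasSum_geometric_half_succ.mul_right c
  rwa [one_mul] at h

/-- If `σ` is non-expanding and `I` is `K`-Lipschitz then every `I ∘ σ^[n]` is `K`-Lipschitz. [folklore] -/
theorem lapLipschitz_comp_iterate {α : Type*} [PseudoMetricSpace α] {σ : α → α} {I : α → ℝ}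
    {K : NNReal} (hσ : LipschitzWith 1 σ) (hI : LipschitzWith K I) (n : ℕ) :
    LipschitzWith K (I ∘ σ^[n]) :=
  (hI.comp ((hσ.iterate n).weaken (one_pow n).le)).weaken (mul_one K).le

/-- Termwise one-sided Lipschitz bound for the `n`-th term of the Neumann series. [folklore] -/
theorem lapLipschitz_term_le {α : Type*} [PseudoMetricSpace α] {σ : α → α} {I : α → ℝ}
    {K : NNReal} (hσ : LipschitzWith 1 σ) (hI : LipschitzWith K I) (n : ℕ) (x y : α) :
    (1 / 2 : ℝ) ^ (n + 1) * I (σ^[n + 1] x) ≤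
      (1 / 2 : ℝ) ^ (n + 1) * I (σ^[n + 1] y) + (1 / 2 : ℝ) ^ (n + 1) * (↑K * dist x y) := by
  have h : I (σ^[n + 1] x) ≤ I (σ^[n + 1] y) + ↑K * dist x y :=
    (lapLipschitz_comp_iterate hσ hI (n + 1)).le_add_mul x y
  have hpos : (0 : ℝ) ≤ (1 / 2 : ℝ) ^ (n + 1) := by positivity
  calc (1 / 2 : ℝ) ^ (n + 1) * I (σ^[n + 1] x)
      ≤ (1 / 2 : ℝ) ^ (n + 1) * (I (σ^[n + 1] y) + ↑K * dist x y) :=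
        mul_le_mul_of_nonneg_left h hpos
    _ = (1 / 2 : ℝ) ^ (n + 1) * I (σ^[n + 1] y) + (1 / 2 : ℝ) ^ (n + 1) * (↑K * dist x y) :=
        mul_add _ _ _

/-- Pointwise absolute convergence of the Neumann series from the bound `|I| ≤ C`. [folklore] -/
theorem lapLipschitz_summable {α : Type*} (σ : α → α) {I : α → ℝ} {C : ℝ} (hC : ∀ q, |I q| ≤ C)
    (q : α) : Summable (fun n : ℕ => (1 / 2 : ℝ) ^ (n + 1) * I (σ^[n + 1] q)) := by
  have hbound : ∀ n : ℕ, ‖(1 / 2 : ℝ) ^ (n + 1) * I (σ^[n + 1] q)‖ ≤ (1 / 2 : ℝ) ^ (n + 1) * C := by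
    intro n
    have hpos : (0 : ℝ) ≤ (1 / 2 : ℝ) ^ (n + 1) := by positivity
    rw [Real.norm_eq_abs, abs_mul, abs_of_nonneg hpos]
    exact mul_le_mul_of_nonneg_left (hC _) hpos
  exact Summable.of_norm_bounded (lapLipschitz_hasSum_geometric_half_succ_mul C).summable hbound

/-- **Stub `stub_lapRecursionLipschitz` (line `Sketch`, crux stmt-AnomalousDissipation-17917) — `C¹` slaving
under the non-expanding inverse lap map**: if `τ⁻¹` is `1`-Lipschitz and the bounded lap integral `I` is
`K`-Lipschitz then the Neumann-series solution `q ↦ ∑ₙ (1/2)^(n+1) I (τ⁻¹^[n+1] q)` of the weight-`½`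
Koopman recursion is `K`-Lipschitz. [folklore] -/
theorem stub_lapRecursionLipschitz : ∀ {α : Type*} [PseudoMetricSpace α] (τ : α ≃ α) (I : α → ℝ) (C : ℝ) (K : NNReal), (∀ q, |I q| ≤ C) → LipschitzWith 1 (⇑τ.symm) → LipschitzWith K I → LipschitzWith K (fun q => ∑' n : ℕ, (1 / 2 : ℝ) ^ (n + 1) * I ((⇑τ.symm)^[n + 1] q)) := by
  intro α _ τ I C K hC hσ hI
  refine LipschitzWith.of_le_add_mul K fun x y => ?_
  exact hasSum_le (fun n => lapLipschitz_term_le hσ hI n x y)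
    (lapLipschitz_summable (⇑τ.symm) hC x).hasSum
    ((lapLipschitz_summable (⇑τ.symm) hC y).hasSum.add
      (lapLipschitz_hasSum_geometric_half_succ_mul (↑K * dist x y)))

end Summit.AnomalousDissipation.AnomalousDissipation.Theorems
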